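import Mathlib
import Summits.Ventures.PercRepro2.FiveTypedAloneA
import Summits.Ventures.PercRepro2.FiveTypedAloneB
import Summits.Ventures.PercRepro2.FiveTypedTable

/-!
# Five typed edges: the alone-end reduction, III (blind cell PercRepro2, night-3, 2026-08-24)
`nonneg_of_alone5`: `noAlone5 … = false` on the labelling gives an alone end (ten cases).
-/

namespace Summit.Ventures.PercRepro2

open UnionCluster

namespace CovForm

namespace TwoTyped

open OneTyped TypedRed

section Alone5

open Classical

variable {V : Type*} {E : Type*} [Fintype E] [DecidableEq E] {R : Type*} [Field R]
  [LinearOrder R] [IsStrictOrderedRing R]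
variable (ends : E → Sym2 V) (o a₁ a₂ a₃ b : V)

/-- **A typed edge with an alone end** (five typed edges): the count is nonnegative. -/
lemma nonneg_of_alone5 (hall4 : allOk4 = true) (e₁ e₂ e₃ e₄ e₅ : E) (z : Config E) (τ : E → ℕ)
    (hτ : ∀ e ∈ ({e₁, e₂, e₃, e₄, e₅} : Finset E), τ e = 1 ∨ τ e = 2) (z0 : Config E)
    (hz0c : closedOn ({e₁, e₂, e₃, e₄, e₅} : Finset E) z = z0) (ps : Fin 5 → V × V)
    (hends₁ : ends e₁ = s((ps 0).1, (ps 0).2))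
    (hends₂ : ends e₂ = s((ps 1).1, (ps 1).2))
    (hends₃ : ends e₃ = s((ps 2).1, (ps 2).2))
    (hends₄ : ends e₄ = s((ps 3).1, (ps 3).2))
    (hends₅ : ends e₅ = s((ps 4).1, (ps 4).2))
    (hA : noAlone5 (lab ends o a₁ a₂ a₃ b (xsOf5 ps) z0 5) (lab ends o a₁ a₂ a₃ b (xsOf5 ps) z0 6) (lab ends o a₁ a₂ a₃ b (xsOf5 ps) z0 7) (lab ends o a₁ a₂ a₃ b (xsOf5 ps) z0 8) (lab ends o a₁ a₂ a₃ b (xsOf5 ps) z0 9) (lab ends o a₁ a₂ a₃ b (xsOf5 ps) z0 10) (lab ends o a₁ a₂ a₃ b (xsOf5 ps) z0 11) (lab ends o a₁ a₂ a₃ b (xsOf5 ps) z0 12) (lab ends o a₁ a₂ a₃ b (xsOf5 ps) z0 13) (lab ends o a₁ a₂ a₃ b (xsOf5 ps) z0 14) = false) :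
    0 ≤ typedCount {e₁, e₂, e₃, e₄, e₅} z τ (K3 ends o a₁ a₂ a₃ b : Config E → Config E → Config E → R) := by
  set f := lab ends o a₁ a₂ a₃ b (xsOf5 ps) z0 with hfdef
  have hf : ∀ p q, f p = f q ↔ Conn ends z0 (pt o a₁ a₂ a₃ b (xsOf5 ps) p) (pt o a₁ a₂ a₃ b (xsOf5 ps) q) :=
    fun p q => lab_eq_iff ends o a₁ a₂ a₃ b (xsOf5 ps) z0 p q
  have hle : ∀ i, f i ≤ i := lab_le ends o a₁ a₂ a₃ b (xsOf5 ps) z0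
  simp only [noAlone5, Bool.and_eq_false_iff, decide_eq_false_iff_not, ne_eq, not_or, not_not] at hA
  rcases hA with (((((((((h | h) | h) | h) | h) | h) | h) | h) | h) | h)
  · exact nonneg_of_alone5a ends o a₁ a₂ a₃ b hall4 e₁ e₂ e₃ e₄ e₅ z τ hτ z0 hz0c ps hends₁ hends₂ hends₃ hends₄ hends₅ (by simp only []; exact (Or.inl h))
  · exact nonneg_of_alone5a ends o a₁ a₂ a₃ b hall4 e₁ e₂ e₃ e₄ e₅ z τ hτ z0 hz0c ps hends₁ hends₂ hends₃ hends₄ hends₅ (by simp only []; exact (Or.inr (Or.inl h)))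
  · exact nonneg_of_alone5a ends o a₁ a₂ a₃ b hall4 e₁ e₂ e₃ e₄ e₅ z τ hτ z0 hz0c ps hends₁ hends₂ hends₃ hends₄ hends₅ (by simp only []; exact (Or.inr (Or.inr (Or.inl h))))
  · exact nonneg_of_alone5a ends o a₁ a₂ a₃ b hall4 e₁ e₂ e₃ e₄ e₅ z τ hτ z0 hz0c ps hends₁ hends₂ hends₃ hends₄ hends₅ (by simp only []; exact (Or.inr (Or.inr (Or.inr (Or.inl h)))))
  · exact nonneg_of_alone5a ends o a₁ a₂ a₃ b hall4 e₁ e₂ e₃ e₄ e₅ z τ hτ z0 hz0c ps hends₁ hends₂ hends₃ hends₄ hends₅ (by simp only []; exact (Or.inr (Or.inr (Or.inr (Or.inr h)))))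
  · exact nonneg_of_alone5b ends o a₁ a₂ a₃ b hall4 e₁ e₂ e₃ e₄ e₅ z τ hτ z0 hz0c ps hends₁ hends₂ hends₃ hends₄ hends₅ (by simp only []; exact (Or.inl h))
  · exact nonneg_of_alone5b ends o a₁ a₂ a₃ b hall4 e₁ e₂ e₃ e₄ e₅ z τ hτ z0 hz0c ps hends₁ hends₂ hends₃ hends₄ hends₅ (by simp only []; exact (Or.inr (Or.inl h)))
  · exact nonneg_of_alone5b ends o a₁ a₂ a₃ b hall4 e₁ e₂ e₃ e₄ e₅ z τ hτ z0 hz0c ps hends₁ hends₂ hends₃ hends₄ hends₅ (by simp only []; exact (Or.inr (Or.inr (Or.inl h))))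
  · exact nonneg_of_alone5b ends o a₁ a₂ a₃ b hall4 e₁ e₂ e₃ e₄ e₅ z τ hτ z0 hz0c ps hends₁ hends₂ hends₃ hends₄ hends₅ (by simp only []; exact (Or.inr (Or.inr (Or.inr (Or.inl h)))))
  · exact nonneg_of_alone5b ends o a₁ a₂ a₃ b hall4 e₁ e₂ e₃ e₄ e₅ z τ hτ z0 hz0c ps hends₁ hends₂ hends₃ hends₄ hends₅ (by simp only []; exact (Or.inr (Or.inr (Or.inr (Or.inr h)))))

end Alone5

end TwoTyped

end CovForm

end Summit.Ventures.PercRepro2
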